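import Mathlib
import HarnessLib
import HarnessLib.Audit
import Summits.AtomisticToContinuum.Statement
import Literature.MathematicalPhysics.QuantumManyBody.PeriodicBoseGas
import Literature.Analysis.UnboundedOperators.HeatKernel
import Summits.AtomisticToContinuum.BoseEinsteinCondensation.Theorems.BECInfraredBoundAssembly
import Summits.AtomisticToContinuum.BoseEinsteinCondensation.Theorems.BECCutLineWeakDisorderOccupationStability
import HarnessLib.Audit.Status.Attr

/-!
Route: BECRieszReverseHolder

# Route BECRieszReverseHolder — positive ground-state slices are reverse-Hölder at every scale —
Riesz s = d−1 shadow (trace of a 4-D Coulomb field), its local law, John–Nirenberg ⇒ flat-mode BEC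

X = PositiveZeroMode: it suffices to show that for every repulsive finite-range v and all small ρ,
NON-NEGATIVE δ-near-minimisers
(δ chosen after N) of the Dirichlet N-body energy in the box Λ_L, L = (N/ρ)^{1/3}, occupy the flat
mode φ₀ = L^{-3/2}1_Λ
macroscopically, ⟨φ₀, γ_Ψ φ₀⟩ ≥ cN. For Ψ ≥ 0 this is the SLICE identity ⟨φ₀,γ_Ψφ₀⟩/N = L⁻³ ∫dX̂
(∫_Λ Ψ(y,X̂) dy)², i.e. a
reverse-Hölder (A_∞-type) property of the conditional one-body weight w_X̂ = Ψ(·,X̂)² = e^{−W_X̂}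
("landscape" W), on average over the
environment X̂. Card riesz-dtn-trace-bmo-landscape (spine; this route re-opens its retired gen-1
route BECRieszLandscape with a deciding
theorem and one new typed classical crux): beyond the healing length ξ the landscape is b·h_X̂, h
the potential of a super-Coulombic RIESZ
gas of exponent s = d−1 = 2 at small coupling Γ = bρ^{2/3} = 2π^{-3/2}(ρa³)^{1/6} (Reatto–Chester
tail; = trace on the slice ℝ³ of a
4-D Coulomb/harmonic-extension potential), whose local laws bound the oscillation / exponential
moments of h scale by scale, and
John–Nirenberg turns bounded mean oscillation into reverse Hölder. X is filed through its robust
two-scale form CoarseGrainedReverseHolder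
(RH₂ of cube-averaged slices at every fixed resolution ℓ) ∧ MicroscaleFlatness (slice mass on cubes
where y ↦ Ψ(y,X̂) concentrates is a
fraction θ < 1), glued by TwoScaleGlue; the classical engine is typed as RieszShadowFieldMoment
(torus, smeared Riesz-2 Gibbs measure,
uniform exponential moments of the cavity field in the Kac corner ρη³ ≥ 1, bρ^{2/3} ≤ Γ₀); X reaches
the conjunct through the fixed-N
frame GroundStateEnergyFinite, GroundStateRigidity, PositiveNearMinimiserExists, OccupationStability
composed in PositivityTransfer and the
PROVED theorem AtomisticToContinuum.BECInfraredBound.bec_of_zeroMode.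
Lean: `∀ v : ℝ → ENNReal,
Literature.MathematicalPhysics.QuantumManyBody.BoseGas.IsRepulsiveFiniteRange v → ∃ ρ₀ : ℝ, 0 < ρ₀ ∧
∀ ρ : ℝ, 0 < ρ → ρ < ρ₀ → ∃ c : ℝ, 0 < c ∧ ∀ᶠ N : ℕ in Filter.atTop, ∃ δ : ENNReal, 0 < δ ∧ ∀ Ψ :
Literature.MathematicalPhysics.QuantumManyBody.BoseGas.TrialState N
(Literature.MathematicalPhysics.QuantumManyBody.BoseGas.sideLength ρ N),
Literature.MathematicalPhysics.QuantumManyBody.BoseGas.energy v Ψ ≤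
Literature.MathematicalPhysics.QuantumManyBody.BoseGas.groundStateEnergy v N
(Literature.MathematicalPhysics.QuantumManyBody.BoseGas.sideLength ρ N) + δ → (∀ X, Ψ.ψ X = (‖Ψ.ψ X‖
: ℂ)) → ENNReal.ofReal (c * N) ≤ Literature.MathematicalPhysics.QuantumManyBody.BoseGas.occupation N
((Literature.MathematicalPhysics.QuantumManyBody.BoseGas.box
(Literature.MathematicalPhysics.QuantumManyBody.BoseGas.sideLength ρ N)).indicator fun _ =>
((Real.sqrt (Literature.MathematicalPhysics.QuantumManyBody.BoseGas.sideLength ρ N ^ 3))⁻¹ : ℂ))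
Ψ.ψ`

## Assembly
Pure logic given the tree, certified natively: TwoScaleGlue turns the two typed slice cruxes into
PositiveZeroMode, PositivityTransfer (with
the three fixed-N frame items and the existence lemma) turns that into X_B1, and the PROVED theorem
AtomisticToContinuum.BECInfraredBound.bec_of_zeroMode (Theorems/BECInfraredBoundAssembly.lean:
occupation_le_maxOccupation +
le_condensateNumber; imported through the route's `imports`) gives the conjunct
`BoseEinsteinCondensation` (the sub-problem Statement decl
`_root_.BoseEinsteinCondensation`, by name). Deciding theorem (glue.lean, elaborates sorry-free with
the rendered file, axioms propext /
Classical.choice / Quot.sound): `theorem closes (h1 : CoarseGrainedReverseHolder) (h2 :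
MicroscaleFlatness) (h3 : TwoScaleGlue)
(h4 : GroundStateEnergyFinite) (h5 : GroundStateRigidity) (h6 : PositiveNearMinimiserExists) (h7 :
OccupationStability)
(h8 : PositivityTransfer) : _root_.BoseEinsteinCondensation :=
AtomisticToContinuum.BECInfraredBound.bec_of_zeroMode (h8 h4 h5 h6 h7 (h3 h1 h2))`.
RieszShadowFieldMoment (rank 3) and the informal BoseRieszMembership (rank 4, filed right after
open) are the intended PROOF of
CoarseGrainedReverseHolder, not assembly inputs.

Rationale: WHY THIS LINE. The barrier audit
Literature.Barriers.AtomisticToContinuum.KineticGapLengthScalesNarrow (scope caveat (b′)) isolates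
positivity of Ψ₀ plus
repulsion as the one untested exit from the energy-window class: every decondensing witness in print
is complex (Galilean boosts) or lives
at v = 0. For Ψ ≥ 0 condensation is exactly non-concentration of the conditional density of one
particle given the others, and −log of
that density is, at pair separations ≫ ξ = (8πρa)^{-1/2}, the potential of a classical Riesz gas
with exponent s = 2 = d−1 (Reatto–Chester
/ McMillan shadow: ReattoChester1967, Reatto1969, McMillan1965; Riesz conventions Lewin2022,
Serfaty2024) at small coupling — precisely
the super-Coulombic class d−2 < s < d for which local laws down to the microscale, fluctuation
bounds and exponential moments of the
potential now exist (PeilenSerfaty2025 = arXiv:2511.18623 Thm 1, Cor. 1.1, Thm 2;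
ArmstrongSerfaty2021; LebleSerfaty2017;
PetracheSerfaty2015 and CaffarelliSilvestre2007 for the extension representation that makes the
Riesz-2 energy on ℝ³ a LOCAL Coulomb energy
in ℝ⁴₊; concentration of linear statistics arXiv:2209.00587). Imported areas: Coulomb/Riesz-gas
probability (local laws, exponential
moments of linear statistics), real-variable harmonic analysis (A_∞ ⇔ reverse Hölder, John–Nirenberg
— the tree proves
Literature.Analysis.FunctionSpaces.john_nirenberg_holds), point-process conditioning (GNZ/Papangelou
slices). Versus the open routes:
no gap, no energy asymptotics, no RG, no reflection positivity; versus the sibling Riesz route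
BECRieszShadow (card
riesz-shadow-harmonic-extension: torus, Palm–Jensen affinity, teleportation ENTROPY KL(P_x‖P_y),
BoundaryTransferWeak) this line is
Dirichlet (closes through the proved bec_of_zeroMode, no boundary-transfer crux), its currency is
scale-resolved SECOND moments of cube
masses (robust to hard cores, where KL = +∞) and its classical input is an exponential-moment local
law rather than a positive-type
principle. The negatives index (1 BEC entry, BECSwapAffinity.SwapJensen: a sign condition missing at
n = 0) is steered around: every item
here is stated eventually in N with explicit positivity / range hypotheses.

RANKED CRUXES. #0 PositiveZeroMode (target) — X: for every repulsive finite-range v there is ρ₀ > 0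
such that for 0 < ρ < ρ₀ there is c > 0 with: for all large N there is δ > 0 such that every
Dirichlet trial state Ψ in the box of side (N/ρ)^{1/3} with energy ≤ E₀ + δ AND Ψ ≥ 0 pointwise (Ψ =
‖Ψ‖ as a complex number) has flat-mode occupation ⟨φ₀,γ_Ψφ₀⟩ ≥ cN (X_B1 =
stmt-AtomisticToContinuum-0686 restricted to non-negative near-minimisers). (why it might fail:
positive near-minimisers could decondense through phase-free correlated (Jastrow-type) amplitude
structure that repulsion does not penalise at an L-independent rate (KineticGapLengthScalesNarrow
caveat (b′) is untested); the d = 1 hard-core analogue (Girardeau, n₀ ≍ √N) is positive and fails.)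
[LSSY2005, PenroseOnsager1956, Reatto1969,
Literature.Barriers.AtomisticToContinuum.KineticGapLengthScalesNarrow,
Literature.Barriers.AtomisticToContinuum.OneDimensionalHardCore]
#2 CoarseGrainedReverseHolder (crux) — (card R1+R2+R3 in typed, robust form) for every admissible v,
small ρ and every resolution ℓ > 0 there is C such that for all large N = n+1 there is δ > 0 with:
for every non-negative δ-near-minimiser Ψ, partitioning [0,L)³ into m³ congruent cubes Q (m =
⌊L/ℓ⌋), the (N−1)-marginal expectation of the second moment of the cube-averaged normalised slice
density is bounded: m³ ∫dX̂ Σ_Q (∫_Q Ψ(y,X̂)² dy)² / ∫Ψ(y,X̂)² dy ≤ C, i.e. E_μ̂[m³ Σ_Q p_Q²] ≤ C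
uniformly in N (reverse Hölder RH₂ of the coarse-grained slice weight; = 1 + variance of the
coarse-grained landscape to leading order ≈ 1 + O(√(ρa³)); v = 0 gives (3/2)³). Cube masses, not
point values: pointwise RH₂ is false over near-minimisers (C¹ spikes of energy ≤ δ), cube masses are
L²-continuous. [deps: RieszShadowFieldMoment] [difficulty: open-problem] (why it might fail: needs
−log Ψ₀²(·,X̂) bounded below off rare voids at all scales ≥ ℓ uniformly in L: a many-body infrared
term in −log Ψ₀ (u₃ with non-summable vertex — the d=3, T=0 marginal logs) or void statistics fatter
than exp(−cR⁴) against the e^{R/ξ} gain would make E Σ_Q p_Q² grow with N.) [PeilenSerfaty2025,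
ReattoChester1967, Reatto1969, McMillan1965, JohnNirenberg1961, LSSY2005,
Literature.Barriers.AtomisticToContinuum.BogoliubovPerturbationInfrared]
#3 RieszShadowFieldMoment (crux) — (card R2, the classical engine's deliverable, NEW typed item)
uniform exponential moments of the cavity field of the weakly coupled smeared Riesz-2 gas on the
torus: there are Γ₀ > 0 and C such that for all n, L, coupling b > 0, smearing length η ∈ (0, L] and
θ ∈ [0, 4], in the Kac corner ρη³ ≥ 1 and bρ^{2/3} ≤ Γ₀ (ρ = n/L³), with g = g_{η,L} the
heat-kernel-smeared zero-mean Lℤ³-periodic Riesz kernel of exponent 2 (g(x) = 2π^{3/2}∫_{η²}^∞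
t^{-1/2}(Σ_m G_t(x − Lm) − L⁻³)dt ≈ |x|⁻² for η ≪ |x| ≪ L, g(0) = 1/(4η²); =
BECRieszShadow.RieszKernelPositiveType's kernel at s = 2), H = Σ_{i<j} g(X_i − X_j) and h_X(y) = Σ_j
g(y − X_j): ∫_{cell^n} e^{−bH} e^{−θ b h_X(y)} dX ≤ C ∫_{cell^n} e^{−bH} dX for every y. Via Jensen
twice (⨍_cell h = 0, Z_{n+1} ≥ L³Z_n) the case θ = 2 bounds the coarse-grained RH₂ functional of
CoarseGrainedReverseHolder for the Jastrow shadow state e^{−(b/2)Σg} at every resolution; the Bose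
dictionary is b = 2π^{-3/2}(a/ρ)^{1/2}, η = max(ξ, ρ^{-1/3}) with ξ = (8πρa)^{-1/2}, Γ =
2π^{-3/2}(ρa³)^{1/6}. [difficulty: L] (why it might fail: uniformity in L: the kernel is
non-integrable (∫_cell g⁺ ~ L) and the k → 0 modes are strongly coupled (bρĝ(k) ~ bρ/k ≫ 1 at k ~
1/L) although Γ ≪ 1, so no cluster expansion applies; heavier-than-Gaussian void (lower) tails of h
at large scales would make the θ = 2 moment grow with L.) [PeilenSerfaty2025, ArmstrongSerfaty2021,
LebleSerfaty2017, Serfaty2024, arXiv:2209.00587, BrydgesMartin1999]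
#5 MicroscaleFlatness (crux) — (card R1, microscale part) there are ℓ > 0, c₀ > 0 and θ < 1 such
that for all large N = n+1 there is δ > 0 with: for every non-negative δ-near-minimiser Ψ and the
same cube partition at resolution ℓ, the expected slice mass carried by BAD cubes — cubes Q with
(∫_Q Ψ(y,X̂)dy)² < c₀|Q|∫_QΨ(y,X̂)²dy, i.e. on which y ↦ Ψ(y,X̂) concentrates — is at most θ: ∫dX̂
Σ_{Q bad} ∫_Q Ψ(y,X̂)²dy ≤ θ (intended ℓ ≈ ρ^{-1/3}/10 ≫ a: most cubes see no particle and the slice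
is the two-body scattering shape (1 − a/r)₊ × a smooth factor on them; hard cores and the Dirichlet
wall layer cost volume fraction O(ρa³ + ξ/L)). [difficulty: L] (why it might fail: flatness of y ↦
Ψ₀(y,X̂) below ρ^{-1/3} is a one-particle Harnack claim for a function solving no PDE in y alone
(only the 3N-dim equation; Moser/Aizenman–Simon constants degrade with 3N); many-body caging near
hard cores could make a mass-relevant cube family bad for every c₀.) [LSSY2005, McMillan1965,
ReedSimonIV1978, Reatto1969]
#6 GroundStateRigidity (crux) — (frame; verbatim the gen-1 item, η AFTER N as the cube functionals
need) phase rigidity of near-minimisers at fixed N: for admissible v there is ρ₀ such that for ρ <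
ρ₀ and all large N, for every η > 0 there is δ > 0 such that any two δ-near-minimisers Ψ, Φ in the
Dirichlet box of side (N/ρ)^{1/3} satisfy ∫|Ψ − cΦ|² ≤ η for some unit complex c (E₀ < ∞, compact
resolvent, unique positive ground state, spectral gap at fixed N; for v = ⊤ cores via energetic
dominance / connectivity of the dilute component of the hard-sphere configuration space). It is what
lets positivity be assumed in the other cruxes. [difficulty: M] (why it might fail: hard cores /
⊤-shells disconnect the configuration space; uniqueness then needs every non-dilute component
(jammed or caged clusters) to sit strictly above E₀ at each large N — low-density connectivity of
hard-sphere configuration spaces in a box is not in the library and open in general.)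
[ReedSimonIV1978, BaryshnikovBubenikKahle2013, LSSY2005]
#9 TwoScaleGlue (support) — CoarseGrainedReverseHolder → MicroscaleFlatness → PositiveZeroMode. Real
analysis + Fubini: for Ψ ≥ 0, ⟨φ₀,γ_Ψφ₀⟩ = N L⁻³ ∫dX̂ (∫Ψ(y,X̂)dy)² (occupation unfolds along
Matrix.vecCons); pointwise in X̂, with good cubes G, Σ_Q∫_Q Ψ ≥ √(c₀|Q|) Σ_G (∫_QΨ²)^{1/2} and
Hölder Σ_G w_Q ≤ (Σ_G w_Q^{1/2})^{2/3}(Σ w_Q²)^{1/3} give (∫Ψ_X̂)² ≥ c₀ L³ M(X̂)(1−b(X̂))³/C₂(X̂)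
with M the slice mass, b the bad-mass fraction, C₂ = m³Σ_Q w_Q²/M²; then Markov under μ̂ = M dX̂ (∫M
= 1) using E_μ̂ C₂ ≤ C and E_μ̂ b ≤ θ < 1; finally intersect the eventual ranges, min of ρ₀'s and
δ's, shift n+1 ↦ N. [difficulty: provable-now] [LSSY2005, Stein1993]
#9 GroundStateEnergyFinite (support) — for repulsive finite-range v (range R₀) there is ρ₀ > 0 such
that for ρ < ρ₀ and all large N the Dirichlet ground-state energy in the box of side (N/ρ)^{1/3} is
finite (N disjoint symmetric C¹ bumps at mutual distance > R₀, interaction_eq_zero_of_lt_dist).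
[difficulty: provable-now] [LSSY2005]
#9 PositiveNearMinimiserExists (support) — whenever E₀(N, L) < ⊤, for every δ > 0 there is a
δ-near-minimiser Φ ∈ TrialState N L with Φ = ‖Φ‖ pointwise. Construction without mollifiers: from a
δ/2-near-minimiser Ψ put Φ_ε := (√(|Ψ|² + ε²) − ε)/‖·‖₂ — C¹ (|Ψ|² is C¹, t ↦ √(t+ε²) smooth),
symmetric, vanishes exactly where Ψ does (box, cores), |∇Φ_ε| ≤ |∇Ψ| and Φ_ε ≤ |Ψ| pointwise before
normalising, ‖Φ_ε‖₂ → 1; so energy Φ_ε ≤ (E₀ + δ/2)/‖Φ_ε‖₂² ≤ E₀ + δ for small ε. [difficulty: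
provable-now] [LSSY2005, ReedSimonIV1978]
#9 OccupationStability (support) — for a normalised measurable mode u, trial states Ψ, Φ ∈
TrialState (n+1) L and |c| = 1: occ(u,Ψ)^{1/2} ≤ occ(u,Φ)^{1/2} + (n+1)^{1/2}‖Ψ − cΦ‖₂ (F_Ψ(Y) =
⟨u,Ψ(·,Y)⟩, |F_Ψ − cF_Φ| ≤ ‖(Ψ−cΦ)(·,Y)‖₂, Minkowski in L²(dY), occ(cΦ) = occ(Φ)). [difficulty:
provable-now] [LSSY2005, PenroseOnsager1956]
#10 PositivityTransfer (support) — GroundStateEnergyFinite → GroundStateRigidity →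
PositiveNearMinimiserExists → OccupationStability → PositiveZeroMode → X_B1 (flat-mode occupation ≥
(c/4)N for ALL δ-near-minimisers, verbatim the hypothesis of the proved
AtomisticToContinuum.BECInfraredBound.bec_of_zeroMode = the body of stmt-AtomisticToContinuum-0686):
for ρ below the four thresholds and N in the four eventual ranges take η = c/4, δ = min(δ_pos,
δ_rig(η)); a δ-near-minimiser Ψ and a positive δ-near-minimiser Φ (exists since E₀ ≠ ⊤) are η-close
up to a unit phase, occ(Φ) ≥ cN, and stability gives √occ(Ψ) ≥ √(cN) − √N√η = √(cN)/2 (ENNReal rpow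
bookkeeping; N = 0 excluded eventually). [difficulty: provable-now] [LSSY2005, ReedSimonIV1978,
PenroseOnsager1956]

TWO-LAYER PLAN. CoarseGrainedReverseHolder ⇐ RieszShadowFieldMoment → BoseRieszMembership →
CoarseGrainedReverseHolder, where BoseRieszMembership (rank 4,
informal at open: "|Ψ₀|² is in the Bose–Riesz class") is the comparison of the true slices with the
tilted shadow slices e^{−b h_X̂} in
coarse exponential-oscillation norm plus domination of the true (N−1)-marginal's field moments by
the shadow's (θ ≤ 4 is why the
classical item carries θ); glue: Jensen twice + Hölder in the change of measure.
RieszShadowFieldMoment ⇐ (extension representation: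
Riesz-2 energy on the slice = Dirichlet energy of the harmonic extension to ℝ⁴₊,
CaffarelliSilvestre2007 / PetracheSerfaty2015) →
(mesoscopic local law + exponential moments in the Kac corner, PeilenSerfaty2025-type bootstrap
without confinement) → item.
MicroscaleFlatness ⇐ SliceHarnack (Feynman–Kac bridge comparison in the tagged coordinate at scale ℓ
≪ ρ^{-1/3}) → CoreLayer (excluded
volume O(ρa³), wall layer O(ξ/L)) → MicroscaleFlatness. GroundStateRigidity ⇐ (a.e.-finite v:
compact resolvent + Perron–Frobenius) →
HardCoreLimit (monotone forms / energetic dominance of the dilute component) → GroundStateRigidity.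
k ≤ 3 each, depth 1.

KILL CRITERIA. ¬CoarseGrainedReverseHolder for some admissible v at arbitrarily small ρ (E_μ̂ Σ_Q
p_Q g_Q² unbounded along N at a fixed ℓ, e.g. from a
rigorous lower bound on void probabilities of |Ψ₀|² slower than the landscape gain, or from an
infrared many-body term) closes the route:
`close --reason refuted:CoarseGrainedReverseHolder`. ¬RieszShadowFieldMoment (the classical engine
fails even for the pure shadow) ⇒ the
card's engine is dead: close `refuted:RieszShadowFieldMoment` unless the refutation is a
corner/normalisation misstatement (then repair
with a restated item). ¬PositiveZeroMode kills every positivity route at once (hand to the negatives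
index; card family riesz-*/palm-*/
renyi-*/swap-* dies). ¬MicroscaleFlatness alone ⇒ pivot: restate with balls and a maximal-function
threshold at smaller ℓ (new item).
¬GroundStateRigidity via a hard-core degeneracy witness ⇒ restate for a.e.-finite v and add the
monotone hard-core limit as support.
X_B1 (stmt-AtomisticToContinuum-0686) proved elsewhere moots the route (superseded).

NOT DECOMPOSED YET. BoseRieszMembership (rank 4) is filed informal right after open: typing it needs
the scattering solution f_v and a cut-off as functions
(shared definition requests of BECRieszShadow) and a settled choice of the coarse
exponential-oscillation norm; the θ-range and corner
constants of RieszShadowFieldMoment versus PeilenSerfaty2025's β ≥ 1 window (their bootstrap is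
stated for confined gases in ℝ^d; here:
torus, no confinement, Kac corner — a different but easier-looking regime, not in print); the
extension identity used inside the engine;
constants c₀, θ, C as functions of ρa³; the dyadic/cube John–Nirenberg lemma from
Literature.Analysis.FunctionSpaces.john_nirenberg_holds
(balls) that a BMO-form proof of CoarseGrainedReverseHolder would call; the periodic twin of X
(would feed BoundaryTransferWeak users);
T > 0. All are layer-2 children or prover-side `--supports` lemmas.

CHEAPEST FALSIFIER. (i) v = 0 (admissible; every ρ): the Dirichlet ground state ∏(2/L)^{1/2} sin
gives m³Σ_Q p_Q² → (3/2)³ = 3.375, no bad cubes for c₀ < 1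
at fixed ℓ as L → ∞, flat-mode occupation (8/π²)³N ≈ 0.53N; near-minimisers are handled by δ after N
(gap 3π²/L²) — done by hand, passes.
(ii) RieszShadowFieldMoment at Poisson level: cumulants of θbh in the corner are ≤
(4Γ₀)^k(ρη³)^{1−2k/3}, bounded — passes; honest test =
Monte-Carlo kit job (refuters): sample the smeared Riesz-2 Gibbs measure at Γ ∈ {0.03, 0.1, 0.3},
ρη³ ∈ {1, 8}, n ∈ {10³,…,10⁵}, estimate
log E e^{−2bh(y)}: growth in n at fixed (Γ, ρη³) retires the item. (iii) VMC kit job: sample X̂ from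
|Ψ_J|² (LSSY/Dyson nearest-neighbour
Jastrow and Reatto–Chester-tailed Jastrow) at ρa³ ∈ {1e-4, 1e-3, 1e-2}, N ∈ {128,…,2048}, ℓ ∈
{ρ^{-1/3}/10, ξ, 4ξ}; estimate m³Σ_Q p_Q²
and the bad-mass fraction at c₀ = 1/2: growth in N at fixed ℓ retires CoarseGrainedReverseHolder for
that class and the line. (iv) Lookup:
does PeilenSerfaty2025 Thm 2 / ArmstrongSerfaty2021 already cover periodic unconfined s = 2 at small
β with smearing η ≥ ρ^{-1/3}? If yes,
rank 3 is `known` and becomes a citation.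

NUMBERS. u(r) = b/r² beyond ξ with b = 2π^{-3/2}(a/ρ)^{1/2} (from S(k) → k/(4√(πρa)), ρŵ(k) =
4√(πρa)/k, FT⁻¹(1/k) = 1/(2π²r²); units ħ = 2m
= 1); Γ := bρ^{2/3} = 2π^{-3/2}(ρa³)^{1/6} (0.036 at ρa³ = 10⁻⁶, 0.11 at 10⁻³); ξ = (8πρa)^{-1/2},
ξρ^{1/3} = (8π(ρa³)^{1/3})^{-1/2} (0.63 at ρa³ = 10⁻³, 1 at
6.3·10⁻⁵, 2.0 at 10⁻⁶), ρξ³ = (8π)^{-3/2}(ρa³)^{-1/2}; the engine is applied with η = max(ξ,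
ρ^{-1/3}); smeared kernel g(0) = 1/(4η²), so b g(0) = Γ/(4(ρ^{1/3}η)²) ≤ Γ₀/4; field variance at
Poisson level b²ρ∫g² ≍
Γ²/(ρ^{1/3}η) ≍ √(ρa³); near part Σ_{r_j<ξ} 2a/r_j ≈ 4πaρξ² = 1/2 (O(1) mean, variance ≍ √(ρa³));
void of radius R lowers the landscape by
≍ R/ξ against Riesz-2 void cost ≍ bρ²R⁴ ≍ Γ(ρ^{1/3}R)⁴; free-gas value of the RH₂ functional (3/2)³;
flat-mode occupation of ∏sin: (8/π²)³ = 0.533;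
PeilenSerfaty2025: local laws for ℓ ≥ ρ_β N^{-1/d}, tails C₁e^{−C₂βNℓ^d}, β-uniform for β ≥ 1 (Thm
1). Items at open: 11 typed (target,
4 cruxes, 5 supports, assembly) + 1 informal crux filed after open = 12 ≤ 15.

DEFINITION REQUESTS. NeutralizedRieszGas is NO LONGER needed for the engine item
(RieszShadowFieldMoment is typed over cellN with the explicit heat-kernel
subordinated kernel, as BECRieszShadow did). Still wanted for typing BoseRieszMembership: the
zero-energy scattering solution f_v of
−Δf + ½vf = 0 as a function with its API (shared request of BECRieszShadow / BECParentAnchor), filed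
with `ledger workitem add --kind
definition` only if no such item exists. Cite fact wanted (not load-bearing): PeilenSerfaty2025 Thm
2 as a named Literature fact once a
torus Riesz Gibbs measure is a Literature object.

Novelty: Searches (2026-08-15, this seat): `lit frontier AtomisticToContinuum --since 2022` (30 rows; BEC
descendants are the kinetic-localisation
class arXiv:2510.20493, arXiv:2603.20776, trial states arXiv:2605.06844 — none
positivity/classical-gas); `lit bridges AtomisticToContinuum
--cross any` (30 rows, no Bose ↔ Riesz/Coulomb-gas bridge); `lit galaxy search "Riesz gas" --star
all` (16 rows: Leblé OCP hyperuniformity,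
Bouali 1-D Riesz, Dandekar–Krapivsky–Mallick dynamics, Beenakker 1-D pair correlation, Leblé thesis,
Lambert–Ledoux–Webb β-ensembles —
nothing on Bose ground states); `lit galaxy search --star pdf --mode bm25 "<Bose Jastrow Riesz local
laws reverse Hölder John–Nirenberg
conditional density>"` (12 rows: Lutsyshyn arXiv:1612.01355 Jastrow for He-4, QMC hard-sphere bosons
PRB 88 214505, 2-D surveys — physics
side only, no rigorous statement); `lit search --source zbmath "Riesz gases fluctuations"` (9:
arXiv:2407.21194, arXiv:2511.18623,
arXiv:2407.15650, arXiv:2107.02592, arXiv:2511.13461, arXiv:2408.04437, arXiv:2403.18750,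
arXiv:2209.00587, arXiv:2507.17504);
`lit search --source arxiv "Jastrow Bose condensate"` (10, VMC/physics); `lit read arXiv:2209.00587`
pp. 1–3 (transport inequalities ⇒
concentration and Moser–Trudinger/Laplace-transform bounds for Riesz-type gases — macroscopic,
mean-field scaling, not microscopic
uniform-in-volume); local hybrid search unavailable this session (searchd rc 75, logged). Plus the
gen-1 seat's searches recorded in
the card (zbMATH  [refs: 2510.20493, 2603.20776, 2605.06844, 1612.01355, 2407.21194, 2511.18623, 2407.15650, 2107.02592, 2511.13461, 2408.04437, 2403.18750, 2209.00587, 2507.17504, PeilenSerfaty2025, Reatto1969, ReattoChester1967, McMillan1965]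

Barriers (technique_class: riesz-gas-local-laws harmonic-extension BMO-positivity): - technique_class: riesz-gas-local-laws harmonic-extension BMO-positivity
- Literature.Barriers.AtomisticToContinuum.KineticGapLengthScales: evaded — no Poincaré/gap at scale
L and no energy window as the only input: the items use positivity of near-minimisers and the
STRUCTURE of their slices; the only scale-L inequality is reverse Hölder/John–Nirenberg, whose
constant is scale-free; δ is chosen after N, so the boost/phase-modulation witnesses of the Narrow
audit are excluded by GroundStateRigidity, and its caveat (b′) (positivity + repulsion untested) is
exactly the bet.
- Literature.Barriers.AtomisticToContinuum.KineticGapLengthScalesNarrow: same; this route is the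
caveat-(b′) exit made into items (PositiveZeroMode is X_B1 restricted to Ψ ≥ 0).
- Literature.Barriers.AtomisticToContinuum.BogoliubovPerturbationInfrared: applies to
CoarseGrainedReverseHolder / BoseRieszMembership only (structure of −log Ψ₀ beyond the pair tail);
evasion: what is needed is an averaged, gauge-invariant, static statement (cube-mass second moments,
exponential moments of the field), not a convergent particle-representation expansion; honest bet
flagged in the rank-2 why-might-fail (u₃ infrared weight).
- Literature.Barriers.AtomisticToContinuum.EnergyAsymptoticsWithoutCondensation: evaded — no use of
e₀(ρ) or LHY precision anywhere; the 1-D witness is reproduced by the mechanism (s = 0 log-gas ⇒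
log-correlated landscape ⇒ no uniform reverse Hölder ⇒ n₀ ≍ √N).
- Literature.Barriers.AtomisticToCont

sub-problem: BoseEinsteinCondensation · status: open · opened planner-plancard-AtomisticToContinuum-BoseEin-e016c558-g2-0 2026-08-15T18:56:32Z · rev 0 · ledger route-AtomisticToContinuum-BECRieszReverseHolder
GENERATED by the gate from the ledger (D-0016/17). Provers cite these decls: `theorem foo : Summit.AtomisticToContinuum.BoseEinsteinCondensation.Theses.BECRieszReverseHolder.<Decl> := …` in Summits/AtomisticToContinuum/BoseEinsteinCondensation/Theorems/<Name>.lean.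
-/

namespace Summit.AtomisticToContinuum.BoseEinsteinCondensation.Theses.BECRieszReverseHolder

open scoped BigOperators Topology Manifold Classical MeasureTheory ProbabilityTheory Matrix InnerProductSpace ComplexConjugate ContinuousMap
open Filter Set Function TopologicalSpace MeasureTheory

attribute [summit_statement] _root_.BoseEinsteinCondensation

/-- item stmt-AtomisticToContinuum-12839 · target · rank 0 · open · by planner
why it might fail: positive near-minimisers could decondense through phase-free correlated (Jastrow-type) amplitude structure that repulsion does not penalise at an L-independent rate (KineticGapLengthScalesNarrow caveat (b′) is untested); the d = 1 hard-core analogue (Girardeau, n₀ ≍ √N) is positive and fails.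
sources: LSSY2005, PenroseOnsager1956, Reatto1969, Literature.Barriers.AtomisticToContinuum.KineticGapLengthScalesNarrow, Literature.Barriers.AtomisticToContinuum.OneDimensionalHardCore
[target] X: for every repulsive finite-range v there is ρ₀ > 0 such that for 0 < ρ < ρ₀ there is c >
0 with: for all large N there is δ > 0 such that every Dirichlet trial state Ψ in the box of side
(N/ρ)^{1/3} with energy ≤ E₀ + δ AND Ψ ≥ 0 pointwise (Ψ = ‖Ψ‖ as a complex number) has flat-mode
occupation ⟨φ₀,γ_Ψφ₀⟩ ≥ cN (X_B1 = stmt-AtomisticToContinuum-0686 restricted to non-negative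
near-minimisers). -/
@[route_item "route-AtomisticToContinuum-BECRieszReverseHolder"]
def PositiveZeroMode : Prop :=
  ∀ v : ℝ → ENNReal, Literature.MathematicalPhysics.QuantumManyBody.BoseGas.IsRepulsiveFiniteRange v → ∃ ρ₀ : ℝ, 0 < ρ₀ ∧ ∀ ρ : ℝ, 0 < ρ → ρ < ρ₀ → ∃ c : ℝ, 0 < c ∧ ∀ᶠ N : ℕ in Filter.atTop, ∃ δ : ENNReal, 0 < δ ∧ ∀ Ψ : Literature.MathematicalPhysics.QuantumManyBody.BoseGas.TrialState N (Literature.MathematicalPhysics.QuantumManyBody.BoseGas.sideLength ρ N), Literature.MathematicalPhysics.QuantumManyBody.BoseGas.energy v Ψ ≤ Literature.MathematicalPhysics.QuantumManyBody.BoseGas.groundStateEnergy v N (Literature.MathematicalPhysics.QuantumManyBody.BoseGas.sideLength ρ N) + δ → (∀ X, Ψ.ψ X = (‖Ψ.ψ X‖ : ℂ)) → ENNReal.ofReal (c * N) ≤ Literature.MathematicalPhysics.QuantumManyBody.BoseGas.occupation N ((Literature.MathematicalPhysics.QuantumManyBody.BoseGas.box (Literature.MathematicalPhysics.QuantumManyBody.BoseGas.sideLength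 ρ N)).indicator fun _ => ((Real.sqrt (Literature.MathematicalPhysics.QuantumManyBody.BoseGas.sideLength ρ N ^ 3))⁻¹ : ℂ)) Ψ.ψ

/-- item stmt-AtomisticToContinuum-12840 · crux · rank 2 · open · by planner
why it might fail: needs −log Ψ₀²(·,X̂) bounded below off rare voids at all scales ≥ ℓ uniformly in L: a many-body infrared term in −log Ψ₀ (u₃ with non-summable vertex — the d=3, T=0 marginal logs) or void statistics fatter than exp(−cR⁴) against the e^{R/ξ} gain would make E Σ_Q p_Q² grow with N.
sources: PeilenSerfaty2025, ReattoChester1967, Reatto1969, McMillan1965, JohnNirenberg1961, LSSY2005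
[crux] (card R1+R2+R3 in typed, robust form) for every admissible v, small ρ and every resolution ℓ
> 0 there is C such that for all large N = n+1 there is δ > 0 with: for every non-negative
δ-near-minimiser Ψ, partitioning [0,L)³ into m³ congruent cubes Q (m = ⌊L/ℓ⌋), the (N−1)-marginal
expectation of the second moment of the cube-averaged normalised slice density is bounded: m³ ∫dX̂
Σ_Q (∫_Q Ψ(y,X̂)² dy)² / ∫Ψ(y,X̂)² dy ≤ C, i.e. E_μ̂[m³ Σ_Q p_Q²] ≤ C uniformly in N (reverse Hölder
RH₂ of the coarse-grained slice weight; = 1 + variance of the coarse-grained landscape to leading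
order ≈ 1 + O(√(ρa³)); v = 0 gives (3/2)³). Cube masses, not point values: pointwise RH₂ is false
over near-minimisers (C¹ spikes of energy ≤ δ), cube masses are L²-continuous. [deps:
RieszShadowFieldMoment] [difficulty: open-problem] -/
@[route_item "route-AtomisticToContinuum-BECRieszReverseHolder", crux]
def CoarseGrainedReverseHolder : Prop :=
  ∀ v : ℝ → ENNReal, Literature.MathematicalPhysics.QuantumManyBody.BoseGas.IsRepulsiveFiniteRange v → ∃ ρ₀ : ℝ, 0 < ρ₀ ∧ ∀ ρ : ℝ, 0 < ρ → ρ < ρ₀ → ∀ ℓ : ℝ, 0 < ℓ → ∃ C : ℝ, ∀ᶠ n : ℕ in Filter.atTop, ∃ δ : ENNReal, 0 < δ ∧ ∀ Ψ : Literature.MathematicalPhysics.QuantumManyBody.BoseGas.TrialState (n + 1) (Literature.MathematicalPhysics.QuantumManyBody.BoseGas.sideLength ρ (n + 1)), Literature.MathematicalPhysics.QuantumManyBody.BoseGas.energy v Ψ ≤ Literature.MathematicalPhysics.QuantumManyBody.BoseGas.groundStateEnergy v (n + 1) (Literature.MathematicalPhysics.QuantumManyBody.BoseGas.sideLength ρ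 (n + 1)) + δ → (∀ X, Ψ.ψ X = (‖Ψ.ψ X‖ : ℂ)) → let L := Literature.MathematicalPhysics.QuantumManyBody.BoseGas.sideLength ρ (n + 1); let m := ⌊L / ℓ⌋₊; ((m : ENNReal) ^ 3 * ∫⁻ X : Fin n → EuclideanSpace ℝ (Fin 3), ((∑ k : Fin 3 → Fin m, (∫⁻ y in {y : EuclideanSpace ℝ (Fin 3) | ∀ i, y i ∈ Set.Ico ((k i : ℝ) * (L / m)) (((k i : ℝ) + 1) * (L / m))}, (‖Ψ.ψ (Matrix.vecCons y X)‖₊ : ENNReal) ^ 2) ^ 2) / (∫⁻ y, (‖Ψ.ψ (Matrix.vecCons y X)‖₊ : ENNReal) ^ 2))) ≤ ENNReal.ofReal C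

/-- item stmt-AtomisticToContinuum-12841 · crux · rank 3 · open · by planner
why it might fail: uniformity in L: the kernel is non-integrable (∫_cell g⁺ ~ L) and the k → 0 modes are strongly coupled (bρĝ(k) ~ bρ/k ≫ 1 at k ~ 1/L) although Γ ≪ 1, so no cluster expansion applies; heavier-than-Gaussian void (lower) tails of h at large scales would make the θ = 2 moment grow with L.
sources: PeilenSerfaty2025, ArmstrongSerfaty2021, LebleSerfaty2017, Serfaty2024, arXiv:2209.00587, BrydgesMartin1999
[crux] (card R2, the classical engine's deliverable, NEW typed item) uniform exponential moments of
the cavity field of the weakly coupled smeared Riesz-2 gas on the torus: there are Γ₀ > 0 and C such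
that for all n, L, coupling b > 0, smearing length η ∈ (0, L] and θ ∈ [0, 4], in the Kac corner ρη³
≥ 1 and bρ^{2/3} ≤ Γ₀ (ρ = n/L³), with g = g_{η,L} the heat-kernel-smeared zero-mean Lℤ³-periodic
Riesz kernel of exponent 2 (g(x) = 2π^{3/2}∫_{η²}^∞ t^{-1/2}(Σ_m G_t(x − Lm) − L⁻³)dt ≈ |x|⁻² for η
≪ |x| ≪ L, g(0) = 1/(4η²); = BECRieszShadow.RieszKernelPositiveType's kernel at s = 2), H = Σ_{i<j}
g(X_i − X_j) and h_X(y) = Σ_j g(y − X_j): ∫_{cell^n} e^{−bH} e^{−θ b h_X(y)} dX ≤ C ∫_{cell^n}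
e^{−bH} dX for every y. Via Jensen twice (⨍_cell h = 0, Z_{n+1} ≥ L³Z_n) the case θ = 2 bounds the
coarse-grained RH₂ functional of CoarseGrainedReverseHolder for the Jastrow shadow state
e^{−(b/2)Σg} at every resolution; the Bose dictionary is b = 2π^{-3/2}(a/ρ)^{1/2}, η = max(ξ,
ρ^{-1/3}) with ξ = (8πρa)^{-1/2}, Γ = 2π^{-3/2}(ρa³)^{1/6}. [difficulty: L] -/
@[route_item "route-AtomisticToContinuum-BECRieszReverseHolder", crux]
def RieszShadowFieldMoment : Prop :=
  ∃ Γ₀ : ℝ, 0 < Γ₀ ∧ ∃ C : ℝ, ∀ (n : ℕ) (L b η θ : ℝ), 0 < L → 0 < b → 0 < η → η ≤ L → 0 ≤ θ → θ ≤ 4 → (1 : ℝ) ≤ (n : ℝ) / L ^ 3 * η ^ 3 → b * ((n : ℝ) / L ^ 3) ^ (2 / 3 : ℝ) ≤ Γ₀ → ∀ g : Literature.MathematicalPhysics.QuantumManyBody.BoseGas.Space → ℝ, g = (fun x => 2 * Real.pi ^ (3 / 2 : ℝ) * ∫ t in Set.Ioi (η ^ 2), t ^ (-(1 / 2 : ℝ))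 * ((∑' m : Fin 3 → ℤ, Literature.Analysis.UnboundedOperators.heatKernel t (x - Literature.MathematicalPhysics.QuantumManyBody.BoseGas.latticeVec L m)) - 1 / L ^ 3)) → ∀ H : Literature.MathematicalPhysics.QuantumManyBody.BoseGas.Config n → ℝ, H = (fun X => ∑ i : Fin n, ∑ j : Fin n with i < j, g (X i - X j)) → ∀ y : Literature.MathematicalPhysics.QuantumManyBody.BoseGas.Space, ∫⁻ X in Literature.MathematicalPhysics.QuantumManyBody.BoseGas.cellN n L, ENNReal.ofReal (Real.exp (-(b * H X) - θ * b * ∑ j : Fin n, g (y - X j))) ≤ ENNReal.ofReal C * ∫⁻ X in Literature.MathematicalPhysics.QuantumManyBody.BoseGas.cellN n L, ENNReal.ofReal (Real.exp (-(b * H X)))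

/-- item stmt-AtomisticToContinuum-12842 · crux · rank 5 · closed · proved by Summit.AtomisticToContinuum.BoseEinsteinCondensation.Theorems.microscaleFlatness_proof @ dfc95003dd45 (prover) · by planner
why it might fail: flatness of y ↦ Ψ₀(y,X̂) below ρ^{-1/3} is a one-particle Harnack claim for a function solving no PDE in y alone (only the 3N-dim equation; Moser/Aizenman–Simon constants degrade with 3N); many-body caging near hard cores could make a mass-relevant cube family bad for every c₀.
sources: LSSY2005, McMillan1965, ReedSimonIV1978, Reatto1969
[crux] (card R1, microscale part) there are ℓ > 0, c₀ > 0 and θ < 1 such that for all large N = n+1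
there is δ > 0 with: for every non-negative δ-near-minimiser Ψ and the same cube partition at
resolution ℓ, the expected slice mass carried by BAD cubes — cubes Q with (∫_Q Ψ(y,X̂)dy)² <
c₀|Q|∫_QΨ(y,X̂)²dy, i.e. on which y ↦ Ψ(y,X̂) concentrates — is at most θ: ∫dX̂ Σ_{Q bad} ∫_Q
Ψ(y,X̂)²dy ≤ θ (intended ℓ ≈ ρ^{-1/3}/10 ≫ a: most cubes see no particle and the slice is the
two-body scattering shape (1 − a/r)₊ × a smooth factor on them; hard cores and the Dirichlet wall
layer cost volume fraction O(ρa³ + ξ/L)). [difficulty: L] -/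
@[route_item "route-AtomisticToContinuum-BECRieszReverseHolder", crux]
def MicroscaleFlatness : Prop :=
  ∀ v : ℝ → ENNReal, Literature.MathematicalPhysics.QuantumManyBody.BoseGas.IsRepulsiveFiniteRange v → ∃ ρ₀ : ℝ, 0 < ρ₀ ∧ ∀ ρ : ℝ, 0 < ρ → ρ < ρ₀ → ∃ ℓ c₀ θ : ℝ, 0 < ℓ ∧ 0 < c₀ ∧ θ < 1 ∧ ∀ᶠ n : ℕ in Filter.atTop, ∃ δ : ENNReal, 0 < δ ∧ ∀ Ψ : Literature.MathematicalPhysics.QuantumManyBody.BoseGas.TrialState (n + 1) (Literature.MathematicalPhysics.QuantumManyBody.BoseGas.sideLength ρ (n + 1)), Literature.MathematicalPhysics.QuantumManyBody.BoseGas.energy v Ψ ≤ Literature.MathematicalPhysics.QuantumManyBody.BoseGas.groundStateEnergy v (n + 1) (Literature.MathematicalPhysics.QuantumManyBody.BoseGas.sideLength ρ (n + 1)) + δ → (∀ X, Ψ.ψ X = (‖Ψ.ψ X‖ : ℂ)) → let L := Literature.MathematicalPhysics.QuantumManyBody.BoseGas.sideLength ρ (n + 1); let m := ⌊L / ℓ⌋₊;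 (∫⁻ X : Fin n → EuclideanSpace ℝ (Fin 3), (∑ k : Fin 3 → Fin m, if (∫⁻ y in {y : EuclideanSpace ℝ (Fin 3) | ∀ i, y i ∈ Set.Ico ((k i : ℝ) * (L / m)) (((k i : ℝ) + 1) * (L / m))}, (‖Ψ.ψ (Matrix.vecCons y X)‖₊ : ENNReal)) ^ 2 < ENNReal.ofReal (c₀ * (L / m) ^ 3) * ∫⁻ y in {y : EuclideanSpace ℝ (Fin 3) | ∀ i, y i ∈ Set.Ico ((k i : ℝ) * (L / m)) (((k i : ℝ) + 1) * (L / m))}, (‖Ψ.ψ (Matrix.vecCons y X)‖₊ : ENNReal) ^ 2 then ∫⁻ y in {y : EuclideanSpace ℝ (Fin 3) | ∀ i, y i ∈ Set.Ico ((k i : ℝ) * (L / m)) (((k i : ℝ) + 1) * (L / m))}, (‖Ψ.ψ (Matrix.vecCons y X)‖₊ : ENNReal) ^ 2 else 0)) ≤ ENNReal.ofReal θ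

/-- item stmt-AtomisticToContinuum-9072 · crux · rank 6 · open · by planner
why it might fail: hard cores / ⊤-shells disconnect the configuration space; uniqueness then needs every non-dilute component (jammed or caged clusters) to sit strictly above E₀ at each large N — low-density connectivity of hard-sphere configuration spaces in a box is not in the library and open in general.
sources: ReedSimonIV1978, BaryshnikovBubenikKahle2013, LSSY2005
[crux] (shared verbatim with BECPalmLandscape stmt-AtomisticToContinuum-3298; the uniqueness input
of the descent) for every repulsive finite-range v there is ρ₀ > 0 such that for 0 < ρ < ρ₀ and all
large N, for every η > 0 there is δ > 0 with: any two δ-near-minimisers Ψ, Φ of the Dirichlet energy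
in the box of side (N/ρ)^{1/3} satisfy ∫|Ψ − cΦ|² ≤ η for some unit complex c (E₀ < ∞, compact
resolvent, unique positive ground state and spectral gap at fixed N). [difficulty: M] -/
@[route_item "route-AtomisticToContinuum-BECRieszReverseHolder", crux]
def GroundStateRigidity : Prop :=
  ∀ v : ℝ → ENNReal, Literature.MathematicalPhysics.QuantumManyBody.BoseGas.IsRepulsiveFiniteRange v → ∃ ρ₀ : ℝ, 0 < ρ₀ ∧ ∀ ρ : ℝ, 0 < ρ → ρ < ρ₀ → ∀ᶠ N : ℕ in Filter.atTop, ∀ η : ℝ, 0 < η → ∃ δ : ENNReal, 0 < δ ∧ ∀ Ψ Φ : Literature.MathematicalPhysics.QuantumManyBody.BoseGas.TrialState N (Literature.MathematicalPhysics.QuantumManyBody.BoseGas.sideLength ρ N), Literature.MathematicalPhysics.QuantumManyBody.BoseGas.energy v Ψ ≤ Literature.MathematicalPhysics.QuantumManyBody.BoseGas.groundStateEnergy v N (Literature.MathematicalPhysics.QuantumManyBody.BoseGas.sideLength ρ N) + δ → Literature.MathematicalPhysics.QuantumManyBody.BoseGas.energy v Φ ≤ Literature.MathematicalPhysics.QuantumManyBody.BoseGas.groundStateEnergy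 v N (Literature.MathematicalPhysics.QuantumManyBody.BoseGas.sideLength ρ N) + δ → ∃ c : ℂ, ‖c‖ = 1 ∧ ∫⁻ X, (‖Ψ.ψ X - c * Φ.ψ X‖₊ : ENNReal) ^ 2 ≤ ENNReal.ofReal η

-- item stmt-AtomisticToContinuum-12602 · support · rank 4 · open · by planner — informal only, no Lean statement yet:
--   [crux] BoseRieszMembership (card riesz-dtn-trace-bmo-landscape R1, rank 4; informal until the
--   scattering solution f_v / a radial cut-off are Literature functions and the coarse
--   exponential-oscillation norm is settled — the intended proof of CoarseGrainedReverseHolder is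
--   RieszShadowFieldMoment + this item). Setting: admissible v, 0 < ρ < ρ₀(v), N = n+1 → ∞, Dirichlet
--   box Λ_L, L = (N/ρ)^{1/3}, Ψ ≥ 0 a δ-near-minimiser with δ = δ(N) after N, μ̂(dX̂) = M(X̂)dX̂ the
--   (N−1)-marginal (M = slice mass), b = 2π^{-3/2}(a/ρ)^{1/2}, η = max(ξ, ρ^{-1/3}) with ξ =
--   (8πρa)^{-1/2}, g = g_{η,L} and h_X̂(y) = Σ_j

/-- item stmt-AtomisticToContinuum-12843 · support · rank 9 · closed · proved by Summit.AtomisticToContinuum.BoseEinsteinCondensation.Theorems.twoScaleGlue_proof (prover) · by planner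
sources: LSSY2005, Stein1993
[support] CoarseGrainedReverseHolder → MicroscaleFlatness → PositiveZeroMode. Real analysis +
Fubini: for Ψ ≥ 0, ⟨φ₀,γ_Ψφ₀⟩ = N L⁻³ ∫dX̂ (∫Ψ(y,X̂)dy)² (occupation unfolds along Matrix.vecCons);
pointwise in X̂, with good cubes G, Σ_Q∫_Q Ψ ≥ √(c₀|Q|) Σ_G (∫_QΨ²)^{1/2} and Hölder Σ_G w_Q ≤ (Σ_G
w_Q^{1/2})^{2/3}(Σ w_Q²)^{1/3} give (∫Ψ_X̂)² ≥ c₀ L³ M(X̂)(1−b(X̂))³/C₂(X̂) with M the slice mass, b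
the bad-mass fraction, C₂ = m³Σ_Q w_Q²/M²; then Markov under μ̂ = M dX̂ (∫M = 1) using E_μ̂ C₂ ≤ C
and E_μ̂ b ≤ θ < 1; finally intersect the eventual ranges, min of ρ₀'s and δ's, shift n+1 ↦ N.
[difficulty: provable-now] -/
@[route_item "route-AtomisticToContinuum-BECRieszReverseHolder", crux]
def TwoScaleGlue : Prop :=
  CoarseGrainedReverseHolder → MicroscaleFlatness → PositiveZeroMode

/-- item stmt-AtomisticToContinuum-12844 · support · rank 9 · closed · proved by Summit.AtomisticToContinuum.BoseEinsteinCondensation.Theorems.groundStateEnergyFinite_proof (prover) · by planner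
sources: LSSY2005
[support] for repulsive finite-range v (range R₀) there is ρ₀ > 0 such that for ρ < ρ₀ and all large
N the Dirichlet ground-state energy in the box of side (N/ρ)^{1/3} is finite (N disjoint symmetric
C¹ bumps at mutual distance > R₀, interaction_eq_zero_of_lt_dist). [difficulty: provable-now] -/
@[route_item "route-AtomisticToContinuum-BECRieszReverseHolder", crux]
def GroundStateEnergyFinite : Prop :=
  ∀ v : ℝ → ENNReal, Literature.MathematicalPhysics.QuantumManyBody.BoseGas.IsRepulsiveFiniteRange v → ∃ ρ₀ : ℝ, 0 < ρ₀ ∧ ∀ ρ : ℝ, 0 < ρ → ρ < ρ₀ → ∀ᶠ N : ℕ in Filter.atTop, Literature.MathematicalPhysics.QuantumManyBody.BoseGas.groundStateEnergy v N (Literature.MathematicalPhysics.QuantumManyBody.BoseGas.sideLength ρ N) ≠ ⊤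

/-- item stmt-AtomisticToContinuum-12845 · support · rank 9 · closed · proved by Summit.AtomisticToContinuum.BoseEinsteinCondensation.Theorems.positiveNearMinimiserExists_proof (prover) · by planner
sources: LSSY2005, ReedSimonIV1978
[support] whenever E₀(N, L) < ⊤, for every δ > 0 there is a δ-near-minimiser Φ ∈ TrialState N L with
Φ = ‖Φ‖ pointwise. Construction without mollifiers: from a δ/2-near-minimiser Ψ put Φ_ε := (√(|Ψ|² +
ε²) − ε)/‖·‖₂ — C¹ (|Ψ|² is C¹, t ↦ √(t+ε²) smooth), symmetric, vanishes exactly where Ψ does (box,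
cores), |∇Φ_ε| ≤ |∇Ψ| and Φ_ε ≤ |Ψ| pointwise before normalising, ‖Φ_ε‖₂ → 1; so energy Φ_ε ≤ (E₀ +
δ/2)/‖Φ_ε‖₂² ≤ E₀ + δ for small ε. [difficulty: provable-now] -/
@[route_item "route-AtomisticToContinuum-BECRieszReverseHolder", crux]
def PositiveNearMinimiserExists : Prop :=
  ∀ (v : ℝ → ENNReal) (N : ℕ) (L : ℝ), Literature.MathematicalPhysics.QuantumManyBody.BoseGas.groundStateEnergy v N L ≠ ⊤ → ∀ δ : ENNReal, 0 < δ → ∃ Φ : Literature.MathematicalPhysics.QuantumManyBody.BoseGas.TrialState N L, Literature.MathematicalPhysics.QuantumManyBody.BoseGas.energy v Φ ≤ Literature.MathematicalPhysics.QuantumManyBody.BoseGas.groundStateEnergy v N L + δ ∧ ∀ X, Φ.ψ X = (‖Φ.ψ X‖ : ℂ)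

/-- item stmt-AtomisticToContinuum-9074 · support · rank 9 · closed · proved by Summit.AtomisticToContinuum.BoseEinsteinCondensation.Theorems.occupationStability_proof @ 4a4e6659c153 (prover) · by planner
sources: LSSY2005, PenroseOnsager1956
[support] (shared verbatim with BECPalmLandscape stmt-AtomisticToContinuum-3300) for a normalised
measurable mode u, trial states Ψ, Φ ∈ TrialState (n+1) L and |c| = 1: occ(u,Ψ)^{1/2} ≤
occ(u,Φ)^{1/2} + (n+1)^{1/2}·‖Ψ − cΦ‖₂ (Minkowski in L²(dY); occ(cΦ) = occ(Φ)). [difficulty: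
provable-now] -/
@[route_item "route-AtomisticToContinuum-BECRieszReverseHolder", crux]
def OccupationStability : Prop :=
  ∀ (n : ℕ) (L : ℝ) (u : Literature.MathematicalPhysics.QuantumManyBody.BoseGas.Space → ℂ), MeasureTheory.AEStronglyMeasurable u MeasureTheory.volume → ∫⁻ x, (‖u x‖₊ : ENNReal) ^ 2 = 1 → ∀ (Ψ Φ : Literature.MathematicalPhysics.QuantumManyBody.BoseGas.TrialState (n + 1) L) (c : ℂ), ‖c‖ = 1 → Literature.MathematicalPhysics.QuantumManyBody.BoseGas.occupation (n + 1) u Ψ.ψ ^ (1 / 2 : ℝ) ≤ Literature.MathematicalPhysics.QuantumManyBody.BoseGas.occupation (n + 1) u Φ.ψ ^ (1 / 2 : ℝ) + ((n + 1 : ℕ) : ENNReal) ^ (1 / 2 : ℝ) * (∫⁻ X, (‖Ψ.ψ X - c * Φ.ψ X‖₊ : ENNReal) ^ 2) ^ (1 / 2 : ℝ)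

/-- `OccupationStability` holds: proved by `Summit.AtomisticToContinuum.BoseEinsteinCondensation.Theorems.occupationStability_proof` @ 4a4e6659c153. -/
theorem OccupationStability_holds : OccupationStability := _root_.Summit.AtomisticToContinuum.BoseEinsteinCondensation.Theorems.occupationStability_proof

/-- item stmt-AtomisticToContinuum-12846 · support · rank 10 · closed · proved by Summit.AtomisticToContinuum.BoseEinsteinCondensation.Theorems.positivityTransfer_proof (prover) · by planner
sources: LSSY2005, ReedSimonIV1978, PenroseOnsager1956
[support] GroundStateEnergyFinite → GroundStateRigidity → PositiveNearMinimiserExists →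
OccupationStability → PositiveZeroMode → X_B1 (flat-mode occupation ≥ (c/4)N for ALL
δ-near-minimisers, verbatim the hypothesis of the proved
AtomisticToContinuum.BECInfraredBound.bec_of_zeroMode = the body of stmt-AtomisticToContinuum-0686):
for ρ below the four thresholds and N in the four eventual ranges take η = c/4, δ = min(δ_pos,
δ_rig(η)); a δ-near-minimiser Ψ and a positive δ-near-minimiser Φ (exists since E₀ ≠ ⊤) are η-close
up to a unit phase, occ(Φ) ≥ cN, and stability gives √occ(Ψ) ≥ √(cN) − √N√η = √(cN)/2 (ENNReal rpow
bookkeeping; N = 0 excluded eventually). [difficulty: provable-now] -/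
@[route_item "route-AtomisticToContinuum-BECRieszReverseHolder", crux]
def PositivityTransfer : Prop :=
  GroundStateEnergyFinite → GroundStateRigidity → PositiveNearMinimiserExists → OccupationStability → PositiveZeroMode → (∀ v : ℝ → ENNReal, Literature.MathematicalPhysics.QuantumManyBody.BoseGas.IsRepulsiveFiniteRange v → ∃ ρ₀ : ℝ, 0 < ρ₀ ∧ ∀ ρ : ℝ, 0 < ρ → ρ < ρ₀ → ∃ c : ℝ, 0 < c ∧ ∀ᶠ N : ℕ in Filter.atTop, ∃ δ : ENNReal, 0 < δ ∧ ∀ Ψ : Literature.MathematicalPhysics.QuantumManyBody.BoseGas.TrialState N (Literature.MathematicalPhysics.QuantumManyBody.BoseGas.sideLength ρ N), Literature.MathematicalPhysics.QuantumManyBody.BoseGas.energy v Ψ ≤ Literature.MathematicalPhysics.QuantumManyBody.BoseGas.groundStateEnergy v N (Literature.MathematicalPhysics.QuantumManyBody.BoseGas.sideLength ρ N) + δ → ENNReal.ofReal (c * N) ≤ Literature.MathematicalPhysics.QuantumManyBody.BoseGas.occupation N ((Literature.MathematicalPhysics.QuantumManyBody.BoseGas.box (Literature.MathematicalPhysics.QuantumManyBody.BoseGas.sideLength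 ρ N)).indicator fun _ => ((Real.sqrt (Literature.MathematicalPhysics.QuantumManyBody.BoseGas.sideLength ρ N ^ 3))⁻¹ : ℂ)) Ψ.ψ)

/-- item stmt-AtomisticToContinuum-12847 · assembly · rank 1 · closed · proved by Summit.AtomisticToContinuum.BoseEinsteinCondensation.Theorems.becRieszReverseHolder_assembly_proof @ b630fe723d3e (prover) · by planner
sources: LSSY2005, PenroseOnsager1956
[assembly] CoarseGrainedReverseHolder → MicroscaleFlatness → TwoScaleGlue → GroundStateEnergyFinite
→ GroundStateRigidity → PositiveNearMinimiserExists → OccupationStability → PositivityTransfer →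
BoseEinsteinCondensation (the sub-problem Statement decl, by name; same type as `closes`). -/
@[route_item "route-AtomisticToContinuum-BECRieszReverseHolder"]
def Assembly : Prop :=
  CoarseGrainedReverseHolder → MicroscaleFlatness → TwoScaleGlue → GroundStateEnergyFinite → GroundStateRigidity → PositiveNearMinimiserExists → OccupationStability → PositivityTransfer → _root_.BoseEinsteinCondensation

/-! D-0027 §2.1 — DECIDING THEOREM (planner-authored via `route open/edit --closes-file`; by planner-plancard-AtomisticToContinuum-BoseEin-e016c558-g2-0 2026-08-15T18:56:33Z):
its hypotheses are this route's items and its conclusion the sub-problem Statement (glue_lint), and it elaborates with this file. -/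

@[closes "route-AtomisticToContinuum-BECRieszReverseHolder"] theorem closes (h1 : CoarseGrainedReverseHolder) (h2 : MicroscaleFlatness) (h3 : TwoScaleGlue) (h4 : GroundStateEnergyFinite) (h5 : GroundStateRigidity) (h6 : PositiveNearMinimiserExists) (h7 : OccupationStability) (h8 : PositivityTransfer) : _root_.BoseEinsteinCondensation :=
  _root_.AtomisticToContinuum.BECInfraredBound.bec_of_zeroMode (h8 h4 h5 h6 h7 (h3 h1 h2))

end Summit.AtomisticToContinuum.BoseEinsteinCondensation.Theses.BECRieszReverseHolder
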